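import Summits.Ventures.PercRepro.ProfileBiIndepNormConsPair
import Summits.Ventures.PercRepro.ProfilePointedAverage

/-!
# PercRepro — (NC-pair) AT THE FREE MATROID IS (NMP-I): THE BRIDGE `NormConsPair α → IndepNMP α` (p10, gen 30;
the SUCCESSOR item (5) of the gen 29 CLOSE ADDENDUM)

For `M₁ = freeOn E` every subset of `E` is a flat with trivial closure, `rk₁ X = #X`, and the mixed bi-independent
`i`-sets `BI_i(free, M) = {X ⊆ E : #X = i, E ∖ X ∈ I(M)}` are the COMPLEMENTS of the independent `(n − i)`-sets of `M`.
Given a family `𝒜 ⊆ I_{j+1}(M)`, take the up-set `U = {F ⊆ E : F ⊇ E ∖ A for some A ∈ 𝒜}` and the level `k = n − j − 1`: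
`u_k(U) = #𝒜` (the complements of the members), `u_{k+1}(U) = #∂𝒜` (the complements of the `j`-subsets of members;
automatically independent), `#BI_{k+1} = #I_j`, `#BI_k = #I_{j+1}`, and the (NC-pair) step at `(free, M, U, k)` is exactly
`#𝒜 · #I_j ≤ #∂𝒜 · #I_{j+1}`.

* `gr_freeOn`, `rk_freeOn`, `clF_freeOn`, `isFlatF_freeOn_iff`, `upFlats_freeOn` — the free matroid on a finset;
* `card_filter_powerset_compl` — complementation inside `2^S` preserves cardinalities of filtered families;
* `card_mixedBiIndepSets_freeOn`, `mixedUpCount_freeOn_eq_card`, `mixedUpCount_freeOn_succ_eq_card_shadow` — the four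
  quantities;
* **`indepNMP_of_normConsPair : NormConsPair α → IndepNMP α`** — (NC-pair) ⟹ (NMP-I).
Nothing here asserts (NC-pair) or (NMP-I).
-/

open scoped Matroid

namespace PercRepro.Cogirth

open Finset ThmH Skew

variable {α : Type} [DecidableEq α]

/-! ### The free matroid on a finset -/

omit [DecidableEq α] in
/-- The free matroid on a finset is finite. -/
theorem freeOn_finite (S : Finset α) : (Matroid.freeOn (S : Set α)).Finite :=
  ⟨by rw [Matroid.freeOn_ground]; exact S.finite_toSet⟩

omit [DecidableEq α] in
/-- The ground finset of the free matroid on `S` is `S`. -/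
theorem gr_freeOn (S : Finset α) : haveI := freeOn_finite S; gr (Matroid.freeOn (S : Set α)) = S := by
  haveI := freeOn_finite S
  apply Finset.coe_injective
  rw [coe_gr, Matroid.freeOn_ground]

omit [DecidableEq α] in
/-- Every subset of `S` has full rank in the free matroid. -/
theorem rk_freeOn (S : Finset α) {X : Finset α} (hX : X ⊆ S) :
    haveI := freeOn_finite S; rk (Matroid.freeOn (S : Set α)) X = X.card := by
  haveI := freeOn_finite S
  exact rk_eq_card_of_indep' (Matroid.freeOn_indep_iff.2 (coe_subset.2 hX))

omit [DecidableEq α] in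
/-- The closure of a subset of `S` in the free matroid is itself. -/
theorem clF_freeOn (S : Finset α) {X : Finset α} (hX : X ⊆ S) :
    haveI := freeOn_finite S; clF (Matroid.freeOn (S : Set α)) X = X := by
  haveI := freeOn_finite S
  apply Finset.coe_injective
  rw [coe_clF, Matroid.freeOn_closure_eq]
  exact Set.inter_eq_left.2 (coe_subset.2 hX)

omit [DecidableEq α] in
/-- The flats of the free matroid on `S` are the subsets of `S`. -/
theorem isFlatF_freeOn_iff (S : Finset α) (F : Finset α) :
    haveI := freeOn_finite S; IsFlatF (Matroid.freeOn (S : Set α)) F ↔ F ⊆ S := by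
  haveI := freeOn_finite S
  unfold IsFlatF
  rw [gr_freeOn]
  constructor
  · exact fun h => h.1
  · exact fun h => ⟨h, clF_freeOn S h⟩

omit [DecidableEq α] in
/-- An up-closed family of subsets of `S` is an up-set of flats of the free matroid. -/
theorem upFlats_freeOn (S : Finset α) (U : Finset (Finset α)) (h1 : ∀ F ∈ U, F ⊆ S)
    (h2 : ∀ F ∈ U, ∀ G, G ⊆ S → F ⊆ G → G ∈ U) :
    haveI := freeOn_finite S; UpFlats (Matroid.freeOn (S : Set α)) U := by
  haveI := freeOn_finite S
  refine ⟨fun F hF => (isFlatF_freeOn_iff S F).2 (h1 F hF), fun F hF G hG hFG => ?_⟩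
  exact h2 F hF G ((isFlatF_freeOn_iff S G).1 hG) hFG

/-! ### Complementation inside `2^S` -/

/-- Complementation `Z ↦ S ∖ Z` preserves the cardinality of a filtered family of subsets of `S`. -/
theorem card_filter_powerset_compl (S : Finset α) (p : Finset α → Prop) [DecidablePred p] :
    (S.powerset.filter p).card = (S.powerset.filter (fun Z => p (S \ Z))).card := by
  apply card_bij (fun X _ => S \ X)
  · intro X hX
    rw [mem_filter, mem_powerset] at hX ⊢
    exact ⟨sdiff_subset, by rw [Finset.sdiff_sdiff_eq_self hX.1]; exact hX.2⟩
  · intro X hX X' hX' h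
    rw [mem_filter, mem_powerset] at hX hX'
    have h' : S \ (S \ X) = S \ (S \ X') := by rw [h]
    rwa [Finset.sdiff_sdiff_eq_self hX.1, Finset.sdiff_sdiff_eq_self hX'.1] at h'
  · intro Z hZ
    rw [mem_filter, mem_powerset] at hZ
    refine ⟨S \ Z, ?_, Finset.sdiff_sdiff_eq_self hZ.1⟩
    rw [mem_filter, mem_powerset]
    exact ⟨sdiff_subset, hZ.2⟩

/-- `#(S ∖ Z) = i ↔ #Z = #S − i` for `Z ⊆ S` and `i ≤ #S`. -/
theorem card_sdiff_eq_iff {S Z : Finset α} (hZ : Z ⊆ S) {i : ℕ} (hi : i ≤ S.card) :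
    (S \ Z).card = i ↔ Z.card = S.card - i := by
  rw [card_sdiff_of_subset hZ]
  have := card_le_card hZ
  omega

/-! ### The four quantities at the free matroid -/

variable {M : Matroid α} [M.Finite]

omit [DecidableEq α] in
/-- The independent `m`-sets of `M`, as a filter of `2^(gr M)`. -/
theorem indepSetsF_eq (m : ℕ) :
    indepSetsF M m = (gr M).powerset.filter (fun Z => Z.card = m ∧ rk M Z = Z.card) := by
  unfold indepSetsF
  rw [powersetCard_eq_filter, filter_filter]

/-- `#BI_i(free, M) = #I_{n−i}(M)` for `i ≤ n` (complementation). -/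
theorem card_mixedBiIndepSets_freeOn {i : ℕ} (hi : i ≤ (gr M).card) :
    haveI := freeOn_finite (gr M);
    (mixedBiIndepSets (Matroid.freeOn ((gr M : Finset α) : Set α)) M i).card = (indepSetsF M ((gr M).card - i)).card := by
  haveI := freeOn_finite (gr M)
  unfold mixedBiIndepSets
  rw [gr_freeOn, indepSetsF_eq]
  have h1 : (gr M).powerset.filter (fun X => X.card = i ∧ rk (Matroid.freeOn ((gr M : Finset α) : Set α)) X = X.card ∧
      rk M (gr M \ X) = (gr M \ X).card) =
      (gr M).powerset.filter (fun X => X.card = i ∧ rk M (gr M \ X) = (gr M \ X).card) := by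
    apply filter_congr
    intro X hX
    rw [mem_powerset] at hX
    rw [rk_freeOn (gr M) hX]
    tauto
  rw [h1, card_filter_powerset_compl]
  congr 1
  apply filter_congr
  intro Z hZ
  rw [mem_powerset] at hZ
  rw [Finset.sdiff_sdiff_eq_self hZ, card_sdiff_eq_iff hZ hi]

/-- The up-set generated by the complements of the members of `𝒜`. -/
def complUpset (S : Finset α) (𝒜 : Finset (Finset α)) : Finset (Finset α) :=
  S.powerset.filter (fun F => ∃ A ∈ 𝒜, S \ A ⊆ F)

/-- `complUpset` is an up-set of flats of the free matroid on `S`. -/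
theorem upFlats_complUpset (S : Finset α) (𝒜 : Finset (Finset α)) :
    haveI := freeOn_finite S; UpFlats (Matroid.freeOn (S : Set α)) (complUpset S 𝒜) := by
  apply upFlats_freeOn
  · intro F hF
    exact mem_powerset.1 (mem_filter.1 hF).1
  · intro F hF G hG hFG
    rw [complUpset, mem_filter, mem_powerset] at hF ⊢
    obtain ⟨-, A, hA, hAF⟩ := hF
    exact ⟨hG, A, hA, hAF.trans hFG⟩

/-- `S ∖ A ⊆ S ∖ Z ↔ Z ⊆ A` for `Z ⊆ S`. -/
theorem sdiff_subset_sdiff_iff' {S A Z : Finset α} (hZ : Z ⊆ S) : S \ A ⊆ S \ Z ↔ Z ⊆ A := by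
  constructor
  · intro h z hz
    by_contra hzA
    have : z ∈ S \ A := mem_sdiff.2 ⟨hZ hz, hzA⟩
    exact (mem_sdiff.1 (h this)).2 hz
  · intro h
    exact sdiff_subset_sdiff (Subset.refl S) h

/-- The mixed up-count at the free matroid, in terms of complements: `#{Z ⊆ S : #Z = n − i, Z ∈ I(M), Z ⊆ some A ∈ 𝒜}`. -/
theorem mixedUpCount_freeOn_eq {𝒜 : Finset (Finset α)} {i : ℕ} (hi : i ≤ (gr M).card) :
    haveI := freeOn_finite (gr M);
    mixedUpCount (Matroid.freeOn ((gr M : Finset α) : Set α)) M (complUpset (gr M) 𝒜) i =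
      ((gr M).powerset.filter (fun Z => Z.card = (gr M).card - i ∧ rk M Z = Z.card ∧ ∃ A ∈ 𝒜, Z ⊆ A)).card := by
  haveI := freeOn_finite (gr M)
  unfold mixedUpCount mixedBiIndepSets
  rw [gr_freeOn, filter_filter]
  have h1 : (gr M).powerset.filter (fun X => (X.card = i ∧ rk (Matroid.freeOn ((gr M : Finset α) : Set α)) X = X.card ∧
      rk M (gr M \ X) = (gr M \ X).card) ∧ clF (Matroid.freeOn ((gr M : Finset α) : Set α)) X ∈ complUpset (gr M) 𝒜) =
      (gr M).powerset.filter (fun X => X.card = i ∧ rk M (gr M \ X) = (gr M \ X).card ∧ ∃ A ∈ 𝒜, gr M \ A ⊆ X) := by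
    apply filter_congr
    intro X hX
    rw [mem_powerset] at hX
    rw [rk_freeOn (gr M) hX, clF_freeOn (gr M) hX, complUpset, mem_filter, mem_powerset]
    tauto
  rw [h1, card_filter_powerset_compl]
  congr 1
  apply filter_congr
  intro Z hZ
  rw [mem_powerset] at hZ
  rw [Finset.sdiff_sdiff_eq_self hZ, card_sdiff_eq_iff hZ hi]
  constructor
  · rintro ⟨h1, h2, A, hA, h3⟩
    exact ⟨h1, h2, A, hA, (sdiff_subset_sdiff_iff' hZ).1 h3⟩
  · rintro ⟨h1, h2, A, hA, h3⟩
    exact ⟨h1, h2, A, hA, (sdiff_subset_sdiff_iff' hZ).2 h3⟩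

/-- At level `k = n − j − 1` the up-count is `#𝒜` (for `𝒜 ⊆ I_{j+1}(M)`, `j + 1 ≤ n`). -/
theorem mixedUpCount_freeOn_eq_card {j : ℕ} {𝒜 : Finset (Finset α)} (h𝒜 : 𝒜 ⊆ indepSetsF M (j + 1))
    (hj : j + 1 ≤ (gr M).card) :
    haveI := freeOn_finite (gr M);
    mixedUpCount (Matroid.freeOn ((gr M : Finset α) : Set α)) M (complUpset (gr M) 𝒜) ((gr M).card - (j + 1)) =
      𝒜.card := by
  rw [mixedUpCount_freeOn_eq (by omega)]
  congr 1
  ext Z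
  rw [mem_filter, mem_powerset]
  have hn : (gr M).card - ((gr M).card - (j + 1)) = j + 1 := by omega
  rw [hn]
  constructor
  · rintro ⟨-, hZc, -, A, hA, hZA⟩
    have hA' := h𝒜 hA
    rw [indepSetsF_eq, mem_filter] at hA'
    have : Z = A := eq_of_subset_of_card_le hZA (by omega)
    rw [this]
    exact hA
  · intro hZ
    have hZ' := h𝒜 hZ
    rw [indepSetsF_eq, mem_filter, mem_powerset] at hZ'
    exact ⟨hZ'.1, hZ'.2.1, hZ'.2.2, Z, hZ, Subset.refl Z⟩

/-- At level `k + 1 = n − j` the up-count is `#∂𝒜`. -/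
theorem mixedUpCount_freeOn_succ_eq_card_shadow {j : ℕ} {𝒜 : Finset (Finset α)} (h𝒜 : 𝒜 ⊆ indepSetsF M (j + 1))
    (hj : j + 1 ≤ (gr M).card) :
    haveI := freeOn_finite (gr M);
    mixedUpCount (Matroid.freeOn ((gr M : Finset α) : Set α)) M (complUpset (gr M) 𝒜) ((gr M).card - (j + 1) + 1) =
      (shadow 𝒜).card := by
  rw [mixedUpCount_freeOn_eq (by omega)]
  congr 1
  ext Z
  rw [mem_filter, mem_powerset, mem_shadow_iff_exists_mem_card_add_one]
  have hn : (gr M).card - ((gr M).card - (j + 1) + 1) = j := by omega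
  rw [hn]
  constructor
  · rintro ⟨-, hZc, -, A, hA, hZA⟩
    have hA' := h𝒜 hA
    rw [indepSetsF_eq, mem_filter] at hA'
    exact ⟨A, hA, hZA, by omega⟩
  · rintro ⟨A, hA, hZA, hAc⟩
    have hA' := h𝒜 hA
    rw [indepSetsF_eq, mem_filter, mem_powerset] at hA'
    refine ⟨hZA.trans hA'.1, by omega, rk_eq_card_of_subset_of_rk_eq_card hZA hA'.2.2, A, hA, hZA⟩

/-- **(NC-pair) ⟹ (NMP-I)**: the normalised consecutive step of the pair `(free, M)` at the up-set generated by the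
complements of `𝒜` and the level `n − j − 1` is the normalised matching inequality of `𝒜`. -/
theorem indepNMP_of_normConsPair (h : NormConsPair α) : IndepNMP α := by
  intro M _ j 𝒜 h𝒜
  rcases Nat.lt_or_ge (gr M).card (j + 1) with hn | hn
  · -- no independent `(j+1)`-sets: `𝒜 = ∅`
    have : indepSetsF M (j + 1) = ∅ := by
      unfold indepSetsF
      rw [powersetCard_eq_empty.2 hn, filter_empty]
    rw [this, subset_empty] at h𝒜
    subst h𝒜
    simp
  haveI := freeOn_finite (gr M)
  have hgr : gr (Matroid.freeOn ((gr M : Finset α) : Set α)) = gr M := gr_freeOn (gr M)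
  have hstep := h (Matroid.freeOn ((gr M : Finset α) : Set α)) M hgr (complUpset (gr M) 𝒜)
    (upFlats_complUpset (gr M) 𝒜) ((gr M).card - (j + 1))
  rw [mixedUpCount_freeOn_eq_card h𝒜 hn, mixedUpCount_freeOn_succ_eq_card_shadow h𝒜 hn,
    card_mixedBiIndepSets_freeOn (by omega), card_mixedBiIndepSets_freeOn (by omega)] at hstep
  have e1 : (gr M).card - ((gr M).card - (j + 1) + 1) = j := by omega
  have e2 : (gr M).card - ((gr M).card - (j + 1)) = j + 1 := by omega
  rw [e1, e2] at hstep
  exact hstep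

end PercRepro.Cogirth
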